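import Summits.BirchSwinnertonDyer.BirchSwinnertonDyer.Theses.PrintX8VS
import Literature.NumberTheory.EllipticCurves.AnalyticRankModularityProofs
import Literature.NumberTheory.EllipticCurves.SkinnerUrban2014.PAdicUnitPeriodRatioProofs
import Literature.NumberTheory.EllipticCurves.Sprung2024.ChromaticCharValueRankZeroProofs
import Literature.NumberTheory.EllipticCurves.Sprung2012.ColemanMapSurjectiveProofs
import HarnessLib

/-!
# Route `PrintX8VS`, support items `PublishedInputsX8Core` (stmt-BirchSwinnertonDyer-23004) and
# `PublishedInputsX8` (stmt-BirchSwinnertonDyer-20403): the SLIMMED dependency lists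

D-0154 (2) INPUTS→UNCONDITIONAL, `INPUTS-LIST-2.md` §4 T1 «PackSlim» (cell `pub/bsd-wall`, seat
`bsd-inputs-pack-p1`). `PublishedInputsX8Core` is the conjunction of seven REFEREED named facts
(Burungale–Kobayashi–Ota 2024 Cor A.5 in the ♯/♭ reading, the Modularity Theorem as newform existence,
Sprung 2012 Thm 2.2 / Thm 7.14 / Thm 7.16, Sprung 2024 Lemma 5.9 all-`N`, entireness of `L(E,s)`),
item-stated as the children `InputBKOCorA5SharpFlat` (20412), `InputNewform` (19382),
`InputHondaSystem` (20413), `InputSharpFlatTorsion` (20414), `InputKatoSharpFlatDivisibility` (20415),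
`InputLem59AllN` (19878), `InputEntireLFunction` (19273); `PublishedInputsX8` (20403) is the same list
with the period unit at `3` (`InputPeriodUnitThree`, 19291) inserted as conjunct 7. Over the tree's
LANDED theorems:

* `InputEntireLFunction` is redundant: the newform gives the entire continuation
  (`WeierstrassCurve.hasEntireLFunction_rat_of_exists_isNewformOf`, `AnalyticRankModularityProofs.lean`)
  — `publishedInputsX8Core_of_slim` (7 → 6, every hypothesis a registered item);
* Sprung 2024 Lemma 5.9 all-`N` (`InputLem59AllN`) has the SINGLE residual
  `Sprung2024.lem55AllN_sharpFlat_coinvariants_card` (the Kim/Greenberg coinvariant count, Sprung 2024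
  §5.2 Lemma 5.5): `Sprung2024.lem59AllN_of_lem55AllNcard_of_prop73_prop76`
  (`Sprung2024/ChromaticCharValueRankZeroProofs.lean`) with Sprung 2012 Props 7.3 / 7.6 DISCHARGED
  (`Sprung2012.prop73_colemanFlat_surjective_holds`, `Sprung2012.prop76_colemanSharp_surjective_holds`,
  `Sprung2012/ColemanMapSurjectiveProofs.lean`) — `publishedInputsX8Core_of_slim_lem55` names that
  residual in place of Lemma 5.9;
* the period unit at `3` follows from Mazur 1978 Cor. 4.1 (`ModularForms.mazur_not_dvd_maninConstant_of_odd`)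
  by `SkinnerUrban2014.realPeriodRat_eq_unit_mul_plusPeriod_three_of_mazur` — `publishedInputsX8_of_slim`
  (8 → 7 print inputs).

HONEST FRAMING: pure glue over landed theorems; no cite-only fact is proved here; the remaining inputs
stay print hypotheses and the route stays conditional on them AS TYPED. Nothing here proves BSD; BSD is
not proved by any of this.
-/

set_option autoImplicit false
set_option linter.dupNamespace false

namespace Summit.BirchSwinnertonDyer.BirchSwinnertonDyer.Theorems

open Literature.NumberTheory.EllipticCurves
open Summit.BirchSwinnertonDyer.BirchSwinnertonDyer.Theses.PrintX8VS

/-- **`PublishedInputsX8Core` from six of its seven children, BY NAME** (route `PrintX8VS`, item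
stmt-BirchSwinnertonDyer-23004; INPUTS-LIST-2 T1): `InputEntireLFunction` (19273) is redundant given
`InputNewform` (19382), by `WeierstrassCurve.hasEntireLFunction_rat_of_exists_isNewformOf`
(Diamond–Shurman Thm 8.8.3 ⇒ Thm 5.10.2, a tree theorem). Every hypothesis is a registered item;
pure glue. [folklore] -/
theorem publishedInputsX8Core_of_slim
    (hBKO : InputBKOCorA5SharpFlat) (hmod : InputNewform) (hHonda : InputHondaSystem)
    (hTors : InputSharpFlatTorsion) (hKato : InputKatoSharpFlatDivisibility)
    (h59 : InputLem59AllN) :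
    Summit.BirchSwinnertonDyer.BirchSwinnertonDyer.Theses.PrintX8VS.PublishedInputsX8Core :=
  ⟨hBKO, hmod, hHonda, hTors, hKato, h59,
    WeierstrassCurve.hasEntireLFunction_rat_of_exists_isNewformOf hmod⟩

/-- **`PublishedInputsX8Core` with Sprung 2024 Lemma 5.9 replaced by its single residual**: as
`publishedInputsX8Core_of_slim`, but the child `InputLem59AllN` (Sprung 2024 Lemma 5.9 all-`N`, item
19878) is supplied from the Kim/Greenberg coinvariant count
`Sprung2024.lem55AllN_sharpFlat_coinvariants_card` (Sprung 2024 §5.2 Lemma 5.5; Ray–Sprung 2025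
p. 2343) by the tree theorem `Sprung2024.lem59AllN_of_lem55AllNcard_of_prop73_prop76`, whose other two
inputs — Sprung 2012 Prop 7.3 (`Col♭` onto) and Prop 7.6 (`Col♯` onto) — are DISCHARGED
(`Sprung2012.prop73_colemanFlat_surjective_holds`, `Sprung2012.prop76_colemanSharp_surjective_holds`).
Pure glue; the six hypotheses remain print inputs. [folklore] -/
theorem publishedInputsX8Core_of_slim_lem55
    (hBKO : InputBKOCorA5SharpFlat) (hmod : InputNewform) (hHonda : InputHondaSystem)
    (hTors : InputSharpFlatTorsion) (hKato : InputKatoSharpFlatDivisibility)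
    (h55 : Sprung2024.lem55AllN_sharpFlat_coinvariants_card) :
    Summit.BirchSwinnertonDyer.BirchSwinnertonDyer.Theses.PrintX8VS.PublishedInputsX8Core :=
  publishedInputsX8Core_of_slim hBKO hmod hHonda hTors hKato
    (Sprung2024.lem59AllN_of_lem55AllNcard_of_prop73_prop76 h55
      Sprung2012.prop73_colemanFlat_surjective_holds Sprung2012.prop76_colemanSharp_surjective_holds)

/-- **The in-route edges that make the two dropped children redundant**: `InputNewform` (19382) gives
`InputEntireLFunction` (19273). [folklore] -/
theorem inputEntireLFunction_of_inputNewform (hmod : InputNewform) :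
    Summit.BirchSwinnertonDyer.BirchSwinnertonDyer.Theses.PrintX8VS.InputEntireLFunction :=
  WeierstrassCurve.hasEntireLFunction_rat_of_exists_isNewformOf hmod

/-- … and the coinvariant count `Sprung2024.lem55AllN_sharpFlat_coinvariants_card` alone gives
`InputLem59AllN` (19878 = Sprung 2024 Lemma 5.9 all-`N`), Props 7.3 / 7.6 of Sprung 2012 being tree
theorems. [folklore] -/
theorem inputLem59AllN_of_lem55AllNcard (h55 : Sprung2024.lem55AllN_sharpFlat_coinvariants_card) :
    Summit.BirchSwinnertonDyer.BirchSwinnertonDyer.Theses.PrintX8VS.InputLem59AllN :=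
  Sprung2024.lem59AllN_of_lem55AllNcard_of_prop73_prop76 h55
    Sprung2012.prop73_colemanFlat_surjective_holds Sprung2012.prop76_colemanSharp_surjective_holds

/-- **`PublishedInputsX8` (item 20403, the eight-conjunct bundle) from six children plus Mazur 1978
Cor. 4.1** (8 → 7 print inputs): the core six as in `publishedInputsX8Core_of_slim`, conjunct 7 (the
period unit at `3`, `InputPeriodUnitThree` 19291) from `ModularForms.mazur_not_dvd_maninConstant_of_odd`
by `SkinnerUrban2014.realPeriodRat_eq_unit_mul_plusPeriod_three_of_mazur`, conjunct 8 (entireness)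
from the newform. Pure glue. [folklore] -/
theorem publishedInputsX8_of_slim
    (hBKO : InputBKOCorA5SharpFlat) (hmod : InputNewform) (hHonda : InputHondaSystem)
    (hTors : InputSharpFlatTorsion) (hKato : InputKatoSharpFlatDivisibility)
    (h59 : InputLem59AllN) (hMazur : ModularForms.mazur_not_dvd_maninConstant_of_odd) :
    Summit.BirchSwinnertonDyer.BirchSwinnertonDyer.Theses.PrintX8VS.PublishedInputsX8 :=
  ⟨hBKO, hmod, hHonda, hTors, hKato, h59,
    SkinnerUrban2014.realPeriodRat_eq_unit_mul_plusPeriod_three_of_mazur hMazur,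
    WeierstrassCurve.hasEntireLFunction_rat_of_exists_isNewformOf hmod⟩

/-- **`PublishedInputsX8` from seven of its eight displayed inputs, all registered** (drop only the
entire continuation): the core six plus `InputPeriodUnitThree` (19291). Pure glue. [folklore] -/
theorem publishedInputsX8_of_slim_period
    (hBKO : InputBKOCorA5SharpFlat) (hmod : InputNewform) (hHonda : InputHondaSystem)
    (hTors : InputSharpFlatTorsion) (hKato : InputKatoSharpFlatDivisibility)
    (h59 : InputLem59AllN) (hPer3 : InputPeriodUnitThree) :
    Summit.BirchSwinnertonDyer.BirchSwinnertonDyer.Theses.PrintX8VS.PublishedInputsX8 :=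
  ⟨hBKO, hmod, hHonda, hTors, hKato, h59, hPer3,
    WeierstrassCurve.hasEntireLFunction_rat_of_exists_isNewformOf hmod⟩

end Summit.BirchSwinnertonDyer.BirchSwinnertonDyer.Theorems
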